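import Summits.HubbardSuperconductivity.HubbardSuperconductivity.Theses.IntrinsicLargeN

/-!
# Crux `GroundEigenspaceHomogeneity` (stmt-HubbardSuperconductivity-10971; route `IntrinsicLargeN`,
rank 3) — BIRTH SKELETON `Lines/birth.lean` (BC3)

THE CRUX (fixed; `Theses/IntrinsicLargeN.lean`, decl `GroundEigenspaceHomogeneity`, not restated
here): under certified Kohn–Luttinger `B₁g` attraction + strict dominance at the doping `δ`
(`∀ U ∈ (0,U₁)`, `channelInf B1g ≤ -γU²` and `channelInf B1g + γU² ≤ channelInf χ` for `χ ≠ B1g`)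
there is `U₀ > 0` such that for every `U ∈ (0,U₀)` some `θ < 1` and `L₀` give, on every even
torus `L ≥ L₀`, for ANY two normalised `(N_L, S^z = 0)`-sector ground states `ψ, ψ'` of the pure
model `hubbardTorus 2 L 1 U` (`N_L = 2⌊(1-δ)L²/2⌋`):
`(1 - θ) · Re⟨ψ', Δ_d†Δ_d ψ'⟩ ≤ Re⟨ψ, Δ_d†Δ_d ψ⟩` (`Δ_d = pairField dWaveFormFactor L`) — the
`d_{x²-y²}` pair coherence is COMPARABLE across the (possibly degenerate) sector ground eigenspace.

THE LINE (the crux's own stated mechanism — "all sector ground states share ONE condensate and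
differ only in nodal-quasiparticle / open-shell quantum numbers, which change `⟨Δ_d†Δ_d⟩` by
`O(L³) ≪ L⁴`" — cut at its two natural joints: a multiplicative comparison is an ADDITIVE
sub-extensive spread plus a SCALE that dominates the spread):

1. `stub_subextensiveSpread` — THE BET (size L; carries the crux's whole risk). Under the crux's
   hypothesis: `∃ U₀ > 0, ∀ U ∈ (0,U₀), ∃ C, ∃ L₀, ∀ even L ≥ L₀`, any two normalised sector ground
   states satisfy `Re⟨ψ', Δ_d†Δ_d ψ'⟩ ≤ Re⟨ψ, Δ_d†Δ_d ψ⟩ + C·L³` — the spread of the d-wave pair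
   coherence over the ground eigenspace is SUB-EXTENSIVE on the `L⁴` scale of long-range order,
   at the one-quasiparticle scale `L³ = L² (condensate amplitude `⟨Δ_d⟩ ~ L²`) × O(L)` (open-shell /
   nodal occupations; blocking of single levels changes the pair amplitude by `O(1)` per level,
   von Delft–Ralph 2001 §5; fixed-`N` zero-mode = exact number/phase rotor, Seiringer 2011;
   Koma–Tasaki 1994 / Tasaki 2019 towers live in OTHER charge sectors and cost nothing here;
   momentum `±K` partners have equal coherence and zero cross terms since `Δ_d†Δ_d` carries
   momentum `0`). In a normal (uncondensed) regime the bound is trivial (`⟨Δ_d†Δ_d⟩ = O(L²)` for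
   every state of a Fermi-liquid-like multiplet). Why it might fail = the crux's why-might-fail:
   ACCIDENTAL degeneracy / first-order coexistence putting a condensed and an uncondensed (or a
   `B1g` and a `B2g`) state into one sector ground eigenspace at one `U` along infinitely many even
   `L` — then the spread is `~ L⁴`. NOT implied by the crux (the crux allows a spread `θ·L⁴`) and
   does not imply it (no floor): additive, not multiplicative.
2. `stub_divergentPairStructureFactor` — THE SCALE (size M inside the route, open standalone).
   Under the crux's hypothesis: `∃ U₀ > 0, ∀ U ∈ (0,U₀), ∀ K, ∃ L₀, ∀ even L ≥ L₀`, SOME normalised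
   sector ground state `ψ₀` has `K·L³ ≤ Re⟨ψ₀, Δ_d†Δ_d ψ₀⟩` — the d-wave pair structure factor
   `L⁻²⟨Δ_d†Δ_d⟩` of some ground state diverges faster than `L` (much less than long-range order
   `~ L⁴`; exactly the weakest scale that dominates the spread of stub 1). Inside the route this is
   supplied, with room, by the sibling crux `PairSectorShadow` + the proved supports
   `ReducedBCSAnchor`, `ShadowCondensation` (some ground state has `≥ a·L⁴`, the first half of the
   deciding theorem `closes`); standalone it is the weak-coupling Kohn–Luttinger existence bet
   (FMRT 1993, Chen–Fröhlich–Seifert 1995 Ch. 4, Raghu–Kivelson–Scalapino 2010). Why it might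
   fail: no d-wave (quasi-)order at some small `U` for the certified `δ` (competing order along
   `U_n → 0⁺`). It gives NO comparison between ground states, so it is neither the crux nor the
   summit.

COMPOSITION `GroundEigenspaceHomogeneity_of : Sig.stub_subextensiveSpread →
Sig.stub_divergentPairStructureFactor → GroundEigenspaceHomogeneity` (real proof, no `sorry`;
~25 lines of bookkeeping + linear arithmetic): `U₀ := min U₀ˢ U₀ʷ`; at `U < U₀` take the spread
constant `C`, put `C' := max C 1 > 0`, `θ := 1/2`, `K := 3C'`, `L₀ := max L₀ˢ L₀ʷ`; for even
`L ≥ L₀` and ground states `ψ, ψ'`: the witness `ψ₀` of stub 2 and the spread `ψ ↔ ψ₀` give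
`Re⟨ψ,Δ†Δψ⟩ ≥ 3C'L³ - C'L³ = 2C'L³`, the spread `ψ ↔ ψ'` gives
`Re⟨ψ',Δ†Δψ'⟩ ≤ Re⟨ψ,Δ†Δψ⟩ + C'L³ ≤ (3/2)·Re⟨ψ,Δ†Δψ⟩`, hence `(1 - 1/2)·Re⟨ψ',…⟩ ≤ Re⟨ψ,…⟩`.
`GroundEigenspaceHomogeneity_proof : GroundEigenspaceHomogeneity` cites the two registered stubs
by name (harness convention A12; depends on `sorryAx` only through them).

BC3 PROBES (registrar folder `bc/probe_*.lean`, each stub statement alone in scope, importing only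
the route module): `stub → GroundEigenspaceHomogeneity` and `stub → HubbardSuperconductivity` by
`first | exact? | simpa | aesop` (and each tactic alone, `maxHeartbeats 400000`) — all FAIL; see
`Lines/birth.md` for the table. No landed theorem concludes `IntrinsicLargeN.GroundEigenspaceHomogeneity`.

DISPROOF USED: none on record — `ledger crux ls stmt-HubbardSuperconductivity-10971` shows no
`Disproof.lean`, no `Negative/*` (2026-08-17). Refuter evidence on the item (crux-attack SURVIVES;
`Probe2.body_of_ray`: a one-dimensional ground eigenspace gives the body with `θ = 0`; ED job on
the 4×4 torus non-refuting because of `∃ L₀`) is honoured: both stubs are eventual in `L` and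
stub 1 is exactly the statement the 4×4 spread data would test in kind.

Sources: T. Koma, H. Tasaki, J. Stat. Phys. 76 (1994) 745 (arXiv:cond-mat/9708132 §0.7, Thm 2.3);
H. Tasaki, J. Stat. Phys. 174 (2019) 735 (arXiv:1807.05847 §3.2); R. Seiringer, Commun. Math.
Phys. 306 (2011) 565 (doi:10.1007/s00220-011-1261-6); J. von Delft, D. C. Ralph, Phys. Rep. 345
(2001) 61 §5 (blocking effect at fixed `N`); D. J. Scalapino, Phys. Rep. 250 (1995) 329 §2;
J. Feldman, J. Magnen, V. Rivasseau, E. Trubowitz, Europhys. Lett. 24 (1993) 437/521;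
S. Raghu, S. A. Kivelson, D. J. Scalapino, PRB 81 (2010) 224505 (arXiv:1002.0591).
No definition is introduced besides the abbreviation `KLDominance` of the crux's antecedent
(verbatim); all statements are over existing declarations.
-/

noncomputable section

-- `dupNamespace`: the summit and the problem are both named `HubbardSuperconductivity` (layout D-0022)
set_option linter.dupNamespace false

namespace Summit.HubbardSuperconductivity.HubbardSuperconductivity.Cruxes.GroundEigenspaceHomogeneity.Birth

open scoped Matrix
open Literature.MathematicalPhysics.QuantumLattice
open Summit.HubbardSuperconductivity.HubbardSuperconductivity.Theses.IntrinsicLargeN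

/-! ## Vocabulary (the crux's antecedent, verbatim) -/

/-- Certified Kohn–Luttinger `B₁g` attraction and strict dominance at doping `δ` with margin `γU²`
on the coupling window `(0, U₁)` — VERBATIM the antecedent of the crux (and the body of the route's
support `KohnLuttingerB1gPoint` at `δ`). [cite: RaghuKivelsonScalapino2010, §II–III] -/
def KLDominance (δ γ U₁ : ℝ) : Prop :=
  ∀ U ∈ Set.Ioo (0:ℝ) U₁,
    channelInf (squareDispersion 1 0) (chemicalPotentialOfDensity (squareDispersion 1 0) (1 - δ)) U
        D4Irrep.B1g ≤ -(γ * U ^ 2) ∧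
      ∀ χ : D4Irrep, χ ≠ D4Irrep.B1g →
        channelInf (squareDispersion 1 0) (chemicalPotentialOfDensity (squareDispersion 1 0) (1 - δ))
              U D4Irrep.B1g + γ * U ^ 2 ≤
          channelInf (squareDispersion 1 0) (chemicalPotentialOfDensity (squareDispersion 1 0) (1 - δ))
            U χ

/-! ## Stub statements -/

/-- STUB 1 — SUB-EXTENSIVE SPREAD OF THE d-WAVE PAIR COHERENCE OVER THE SECTOR GROUND EIGENSPACE
(the bet; size L). Under `KLDominance δ γ U₁`: `∃ U₀ > 0, ∀ U ∈ (0,U₀), ∃ C, ∃ L₀`, for every even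
torus `L ≥ L₀` and any two normalised `(N_L, S^z=0)`-sector ground states `ψ, ψ'` of
`hubbardTorus 2 L 1 U`: `Re⟨ψ', Δ_d†Δ_d ψ'⟩ ≤ Re⟨ψ, Δ_d†Δ_d ψ⟩ + C·L³`. Mechanism: exact
number/phase rotor at fixed `N` (one condensate for the whole eigenspace) + open-shell / nodal
bookkeeping (each blocked level moves the pair amplitude `⟨Δ_d⟩ ~ L²` by `O(1)`, at most `O(L)`
levels differ). Why it might fail: accidental degeneracy / first-order coexistence of a condensed
and an uncondensed (or `B1g`/`B2g`) state in one sector ground eigenspace at one `U` along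
infinitely many even `L` (spread `~ L⁴`). Sources: Seiringer 2011 (doi:10.1007/s00220-011-1261-6),
von Delft–Ralph 2001 §5, Koma–Tasaki 1994 Thm 2.3, Tasaki 2019 §3.2, Fano–Ortolani–Parola 1992
(4×4 ground-state irreps and crossings). -/
def Sig.stub_subextensiveSpread : Prop :=
  ∀ δ ∈ Set.Ioo (0:ℝ) (1/2), ∀ γ U₁ : ℝ, 0 < γ → 0 < U₁ → KLDominance δ γ U₁ →
    ∃ U₀ : ℝ, 0 < U₀ ∧ ∀ U ∈ Set.Ioo (0:ℝ) U₀, ∃ C : ℝ, ∃ L₀ : ℕ, ∀ (L : ℕ) [NeZero L], L₀ ≤ L →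
      Even L → ∀ ψ ψ' : Fock (Orb (FermionTorus 2 L)), star ψ ⬝ᵥ ψ = 1 → star ψ' ⬝ᵥ ψ' = 1 →
        IsGroundStateInSector (hubbardTorus 2 L 1 U) (2 * ⌊(1 - δ) * (L : ℝ) ^ 2 / 2⌋₊) 0 ψ →
        IsGroundStateInSector (hubbardTorus 2 L 1 U) (2 * ⌊(1 - δ) * (L : ℝ) ^ 2 / 2⌋₊) 0 ψ' →
          (expect ((pairField dWaveFormFactor L)ᴴ * pairField dWaveFormFactor L) ψ').re ≤
            (expect ((pairField dWaveFormFactor L)ᴴ * pairField dWaveFormFactor L) ψ).re +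
              C * (L : ℝ) ^ 3

/-- STUB 2 — DIVERGENT d-WAVE PAIR STRUCTURE FACTOR OF SOME GROUND STATE (the scale; size M inside
the route, where `PairSectorShadow` + `ReducedBCSAnchor` + `ShadowCondensation` give `≥ a·L⁴` for
some ground state; open standalone). Under `KLDominance δ γ U₁`: `∃ U₀ > 0, ∀ U ∈ (0,U₀), ∀ K,
∃ L₀`, for every even torus `L ≥ L₀` SOME normalised `(N_L, S^z=0)`-sector ground state `ψ₀` of
`hubbardTorus 2 L 1 U` has `K·L³ ≤ Re⟨ψ₀, Δ_d†Δ_d ψ₀⟩` (`L⁻²⟨Δ_d†Δ_d⟩ ≫ L`: far less than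
long-range order, exactly enough to dominate the spread of stub 1). Why it might fail: no d-wave
(quasi-)order at some small `U` for the certified `δ` (a competing order wins along `U_n → 0⁺`).
Sources: Feldman–Magnen–Rivasseau–Trubowitz 1993, Chen–Fröhlich–Seifert 1995 Ch. 4,
Raghu–Kivelson–Scalapino 2010 (arXiv:1002.0591), Scalapino 1995 §2. -/
def Sig.stub_divergentPairStructureFactor : Prop :=
  ∀ δ ∈ Set.Ioo (0:ℝ) (1/2), ∀ γ U₁ : ℝ, 0 < γ → 0 < U₁ → KLDominance δ γ U₁ →
    ∃ U₀ : ℝ, 0 < U₀ ∧ ∀ U ∈ Set.Ioo (0:ℝ) U₀, ∀ K : ℝ, ∃ L₀ : ℕ, ∀ (L : ℕ) [NeZero L], L₀ ≤ L →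
      Even L → ∃ ψ₀ : Fock (Orb (FermionTorus 2 L)), star ψ₀ ⬝ᵥ ψ₀ = 1 ∧
        IsGroundStateInSector (hubbardTorus 2 L 1 U) (2 * ⌊(1 - δ) * (L : ℝ) ^ 2 / 2⌋₊) 0 ψ₀ ∧
          K * (L : ℝ) ^ 3 ≤
            (expect ((pairField dWaveFormFactor L)ᴴ * pairField dWaveFormFactor L) ψ₀).re

/-! ## Registered stubs (the ONLY `sorry`s of this file) -/

/-- Registered stub 1 (sub-extensive spread over the sector ground eigenspace — the bet). -/
theorem stub_subextensiveSpread : Sig.stub_subextensiveSpread := by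
  sorry

/-- Registered stub 2 (divergent d-wave pair structure factor of some ground state — the scale). -/
theorem stub_divergentPairStructureFactor : Sig.stub_divergentPairStructureFactor := by
  sorry

/-! ## The composition: the two stubs imply the crux, by name -/

/-- **THE SKELETON THEOREM.** `Sig.stub_subextensiveSpread → Sig.stub_divergentPairStructureFactor →`
`Summit.HubbardSuperconductivity.HubbardSuperconductivity.Theses.IntrinsicLargeN.GroundEigenspaceHomogeneity`,
a real proof (no `sorry`): `U₀ := min`, `C' := max C 1`, `θ := 1/2`, `K := 3C'`, `L₀ := max`; the
scale witness `ψ₀` and the spread `ψ ↔ ψ₀` floor `Re⟨ψ,Δ†Δψ⟩ ≥ 2C'L³`, the spread `ψ ↔ ψ'` caps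
`Re⟨ψ',Δ†Δψ'⟩ ≤ Re⟨ψ,Δ†Δψ⟩ + C'L³ ≤ (3/2)Re⟨ψ,Δ†Δψ⟩`. Every stub is consumed. [folklore] -/
theorem GroundEigenspaceHomogeneity_of :
    Sig.stub_subextensiveSpread → Sig.stub_divergentPairStructureFactor →
      GroundEigenspaceHomogeneity := by
  intro hS hW δ hδ γ U₁ hγ hU₁ hdom
  -- the two coupling windows, intersected
  obtain ⟨U₂, hU₂, hS'⟩ := hS δ hδ γ U₁ hγ hU₁ hdom
  obtain ⟨U₃, hU₃, hW'⟩ := hW δ hδ γ U₁ hγ hU₁ hdom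
  refine ⟨min U₂ U₃, lt_min hU₂ hU₃, ?_⟩
  intro U hU
  have hUS : U ∈ Set.Ioo (0:ℝ) U₂ := ⟨hU.1, lt_of_lt_of_le hU.2 (min_le_left _ _)⟩
  have hUW : U ∈ Set.Ioo (0:ℝ) U₃ := ⟨hU.1, lt_of_lt_of_le hU.2 (min_le_right _ _)⟩
  -- STUB 1 at `U`: the spread constant `C`, made positive
  obtain ⟨C, L₁, hL₁⟩ := hS' U hUS
  have hC' : 0 < max C 1 := lt_of_lt_of_le one_pos (le_max_right _ _)
  have hCC' : C ≤ max C 1 := le_max_left _ _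
  -- STUB 2 at `U` with the scale `K := 3 · max C 1`
  obtain ⟨L₂, hL₂⟩ := hW' U hUW (3 * max C 1)
  -- `θ := 1/2`, `L₀ := max L₁ L₂`
  refine ⟨1 / 2, by norm_num, max L₁ L₂, ?_⟩
  intro L _ hL hEven ψ ψ' hψ hψ' hGS hGS'
  have hL1 : L₁ ≤ L := le_trans (le_max_left _ _) hL
  have hL2 : L₂ ≤ L := le_trans (le_max_right _ _) hL
  have hL3 : (0:ℝ) ≤ (L : ℝ) ^ 3 := by positivity
  -- the scale witness `ψ₀` and the two spreads `ψ ↔ ψ₀`, `ψ ↔ ψ'`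
  obtain ⟨ψ₀, hψ₀, hGS₀, hK⟩ := hL₂ L hL2 hEven
  have h₀ := hL₁ L hL1 hEven ψ ψ₀ hψ hψ₀ hGS hGS₀
  have h₁ := hL₁ L hL1 hEven ψ ψ' hψ hψ' hGS hGS'
  have hCL : C * (L : ℝ) ^ 3 ≤ max C 1 * (L : ℝ) ^ 3 := mul_le_mul_of_nonneg_right hCC' hL3
  have hK' : 3 * (max C 1 * (L : ℝ) ^ 3) ≤
      (expect ((pairField dWaveFormFactor L)ᴴ * pairField dWaveFormFactor L) ψ₀).re := by
    rw [← mul_assoc]; exact hK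
  -- floor for `ψ`: `2 C' L³ ≤ Re⟨ψ, Δ†Δ ψ⟩`; cap for `ψ'`: `Re⟨ψ', Δ†Δ ψ'⟩ ≤ Re⟨ψ, Δ†Δ ψ⟩ + C' L³`
  have hfloor : 2 * (max C 1 * (L : ℝ) ^ 3) ≤
      (expect ((pairField dWaveFormFactor L)ᴴ * pairField dWaveFormFactor L) ψ).re := by
    linarith
  have hcap : (expect ((pairField dWaveFormFactor L)ᴴ * pairField dWaveFormFactor L) ψ').re ≤
      (expect ((pairField dWaveFormFactor L)ᴴ * pairField dWaveFormFactor L) ψ).re +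
        max C 1 * (L : ℝ) ^ 3 := by
    linarith
  have hpos : 0 ≤ max C 1 * (L : ℝ) ^ 3 := mul_nonneg hC'.le hL3
  linarith

/-- The skeleton in its final shape: the crux BY NAME from the two registered stubs; it becomes
the crux proof when the last `stub_*` is discharged (until then it depends on `sorryAx` through
the stubs only — no `sorry` of its own). [folklore] -/
theorem GroundEigenspaceHomogeneity_proof : GroundEigenspaceHomogeneity :=
  GroundEigenspaceHomogeneity_of stub_subextensiveSpread stub_divergentPairStructureFactor

end Summit.HubbardSuperconductivity.HubbardSuperconductivity.Cruxes.GroundEigenspaceHomogeneity.Birth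

end
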